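import Literature.MathematicalPhysics.QuantumFieldTheory.Balaban1983to89.T4DressedR
import Literature.MathematicalPhysics.QuantumFieldTheory.Balaban1983to89.T4AvgSensitivity

/-!
# `Balaban1983to89.T4OscSandwich` — the OSCILLATION-SHARPENED SANDWICH for the dressed basic renormalization operation
(cell `pub-balaban`, T4-DAG v2 §5 row T4-O3b.K, nodes O3b/O3c; kernel bookkeeping over `T4DressedR` + `T4AvgSensitivity`)

HONEST FRAMING (cell `pub-balaban`, T4-DAG PAGE 1).  The cell's T4 target is the existence AND uniqueness of the
continuum limit of Bałaban's unit-scale averaged loop expectations on a finite torus — a constructive-QFT statement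
strictly beyond ultraviolet stability ([Balaban1989LargeFieldII] Thm 1 p. 355); it is NOT the Yang–Mills mass gap and
NOT the Clay problem.  This module is ONE kernel row (T4-O3b.K) of that spine: the measure-theoretic step at which the
cell's NEW estimate NE1a (`T4AvgSensitivity.LoopOscBound`, a HYPOTHESIS SHAPE, not in print) is CONSUMED by the dressed
basic renormalization operation of [Balaban1989LargeFieldI] (0.3)/(1.100) in the tree's concrete model
(`B15.BasicStep.RopReal`, `T4DressedR.RopRealIn`, convention (α): the dressing rides inside the integrated factor).
It asserts NOTHING about Bałaban's operations or averagings: every theorem is elementary monotonicity of the fibre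
integrals (Mathlib `lmarginal` over the product of the normalized Haar measures), and NE1a enters only as the hypothesis
`(hW : LoopOscBound av dom C_W θ)` of §4.  Value = kernel bookkeeping (exactly where `θ_av < 1` would be spent at ONE
basic step); NOT summit progress, NOT the cell's estimate NE1 (dressed stability), NOT a proof of NE1a.

CITATION HEADER (lean-in-tree rule 2026-08-18).  The printed objects are those already quoted VERBATIM in the headers of
`B15.BasicStep` and `T4DressedR` from the renders of T. Bałaban, *Large field renormalization. I. The basic step of the
ℝ operation*, Commun. Math. Phys. **122** (1989) 175–202 [Balaban1989LargeFieldI] (cell paper B15; PDF page = journal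
page − 174): (0.3) p. 176 "(ℝρ)(V) = Σ_Z ρ(Z″, V) ∫dV⌈_{Z′}ρ(Z, V) / ∫dV⌈_{Z′}ρ(Z″, V)", (0.4) p. 176 "It satisfies the
basic normalization property ∫dV(ℝρ)(V) = ∫dVρ(V).", the density-changing Λ-integration of p. 194 ((1.76)) and the
normalized insertion (1.100)/(1.102) p. 201 — this seat re-read p. 176 [PDF 2] and p. 201 [PDF 27] on the renders
`b2b-balaban-ref1/pages/1989-cmp122-large-field-I/1989-cmp122-large-field-I-p002-x2.png`, `-p027-x2.png` for the SHAPE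
of (0.3)/(1.100) only (a sum over terms `Z` of an INSERT at the field times the fibre integral of the INTEGRATED
expression divided by the fibre integral of the insert).  The manuscript is quoted for CONTEXT and SHAPE only — no
disputed estimate of it is used anywhere below.  The sensitivity hypothesis is the cell's typing around T. Bałaban,
*Averaging operations for lattice gauge theories*, Commun. Math. Phys. **98** (1985) 17–51 [Balaban1985Averaging] (11)
p. 19 (gauge covariance; see the header of `T4AvgSensitivity`) and is NOT PRINTED anywhere (T4-DAG §2 O3c: B7 Props 1–3
are regularity statements, not sensitivities).  No `def … : Prop` hypothesis is introduced here.

THE ROW (T4-DAG v2 §5, verbatim; ° = new in v2): "T4-O3b.K° | O3b/O3c | PROVE | kernel `ropRealIn_osc_sandwich`: the oscillation-sharpened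
dressed-ℝ sandwich e^{−∣t∣·osc_Λ F}ℝ′(ρ) ≤ ℝ′_in(ρe^{tF}) ≤ e^{+∣t∣·osc_Λ F}ℝ′(ρ) with osc supplied by a `LoopOscBound`
(T4-EST-O3c §4 suggestion) | T4DressedR, T4AvgSensitivity | — | S".  The cell file `t4/T4-EST-O3c.md` §0 (f) / §5 states
it with the factor `w(V) = e^{tF(V)}` that the row's shorthand drops: "e^{−|λ|δ_i}·w(V)·(term_i of ℝ(ρ))(V) ≤ (term_i of
ℝ_in(ρ·w))(V) ≤ e^{|λ|δ_i}·w(V)·(term_i of ℝ(ρ))(V) — i.e. the dressing comes out of the Λ_i-integral at the cost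
e^{±|λ|δ_i} with δ_i → 0 geometrically in K − k."  The factor `w(V)` is NECESSARY (for a fibre-independent dressing
`ℝ_in(ρ·w) = w·ℝ(ρ)` exactly, `T4DressedR.ropRealIn_eq_mul_of_fibreIndep`), and it is the form proved here.

DICTIONARY (as in `B15.BasicStep` / `T4DressedR`): a TERM is indexed by `Z : R` (`R` finite); `piece Z = ρ(Z,·)` (the
INTEGRATED expression), `piece (pp Z) = ρ(Z″,·)` (the INSERT), `fib Z` = the finite set of bond variables integrated out in
that term; `V←y := Function.updateFinset V (fib Z) y` runs over the FIBRE THROUGH `V`; `normTerm (fib Z) (piece (pp Z))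
(piece Z) V` = the Z-term of (ℝρ)(V); the dressing is `w = exp(t·F)`, in the cell's use `F = W_C ∘ avg^{n}` =
`loopDressing av j n x w` below (a level-(j+n) loop variable of the n-fold averaged level-j field, `T4AvgSensitivity.iterFrom`).

WHAT IS PROVED (all [folklore]; no measurability hypotheses are needed — only `0 ≤ piece ≤ C`).
§1 POINTWISE FIBRE COMPARISON with bounds valid only ON THE FIBRE THROUGH `V` and only ON THE SUPPORT of the integrated
   density: `fibreIntegral_mul_le_at` (`w(V←y) ≤ M` whenever `f(V←y) ≠ 0` ⇒ `∫⌈(f·w)(V) ≤ M·∫⌈f(V)`) and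
   `mul_fibreIntegral_le_at` (additionally `m ≤ w(V←y)` there ⇒ `m·∫⌈f(V) ≤ ∫⌈(f·w)(V)`).  (`T4DressedR.fibreIntegral_mul_le`
   / `mul_le_fibreIntegral_mul` need GLOBAL bounds by fibre-INDEPENDENT functions; an oscillation bound is neither.)
§2 PER-TERM DRESSED SANDWICH `normTerm_dressed_sandwich_at`: `m·term(ℝρ)(V) ≤ term(ℝ_in(ρ·w))(V) ≤ M·term(ℝρ)(V)` under the
   §1 bounds, required only when the insert is nonzero at `V` (else both sides vanish); `exp_osc_bounds`: `|F(U) − F(V)| ≤ δ`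
   ⇒ `e^{tF(V)}e^{−|t|δ} ≤ e^{tF(U)} ≤ e^{tF(V)}e^{|t|δ}`; `normTerm_exp_osc_sandwich`: the per-term OSCILLATION SANDWICH
   `e^{tF(V)}e^{−|t|δ}·term_Z(ℝρ)(V) ≤ term_Z(ℝ_in(ρ·e^{tF}))(V) ≤ e^{tF(V)}e^{|t|δ}·term_Z(ℝρ)(V)` whenever
   `|F(V←y) − F(V)| ≤ δ` for all `y` with `ρ(Z, V←y) ≠ 0` (and `ρ(Z″, V) ≠ 0`).
§3 SUMMED: `ropRealIn_exp_osc_sandwich` (termwise budgets `δ_Z`: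
   `Σ_Z e^{tF(V)}e^{−|t|δ_Z}·term_Z(ℝρ)(V) ≤ ℝ_in(ρ·e^{tF})(V) ≤ Σ_Z e^{tF(V)}e^{|t|δ_Z}·term_Z(ℝρ)(V)`) and
   `ropRealIn_exp_osc_sandwich_unif` (one budget `δ₀`: `e^{tF(V)}e^{−|t|δ₀}·(ℝρ)(V) ≤ ℝ_in(ρ·e^{tF})(V) ≤ e^{tF(V)}e^{|t|δ₀}·(ℝρ)(V)`)
   — the row's statement with the factor `w(V)` restored; `T4DressedR.ropRealIn_exp_sandwich` is the case `δ₀ = 2B` up to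
   the factor (sup bound `|F| ≤ B`), and the spectator identity is the case `δ₀ = 0`.
§4 CONSUMER FORM (where NE1a is spent): `loopDressing av j n x w := fun U ↦ loopAt (iterFrom av j n U) (walk x w)`;
   `ropRealIn_loopDressing_sandwich`: under `hW : LoopOscBound av dom C_W θ`, for a closed walk `(x, w)` at level `j + n ≤
   m + K` and pieces SUPPORTED IN THE DOMAIN (`piece Z U ≠ 0 → U ∈ dom j` — the small-field characteristic functions of the
   terms), the §3 sandwich holds with `δ_Z = C_W·|w|·|fib Z|·θ^n` (`T4AvgSensitivity.LoopOscBound.updateFinset`);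
   `ropRealIn_loopDressing_sandwich_unif`: with `|fib Z| ≤ N` for all terms, `0 ≤ C_W`, `0 ≤ θ`, the uniform form with
   `δ₀ = C_W·|w|·N·θ^n` — "the observable leaves the step's Λ-integrals at cost e^{±|t|δ₀}", δ₀ geometric in n iff θ < 1.

Located items NOT touched (cell records): the analytic and locality content of NE1 (T4-DAG §2 O3b (ii)–(iii): complex
analytic extensions, non-factorization over components for non-abelian G — `T4DressedR` header (L4)–(L5)); positivity of
the pieces (real fields) is used throughout, as in `T4DressedR` (L5).  Imports `T4DressedR` (carrier, `RopRealIn`) and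
`T4AvgSensitivity` (`LoopOscBound`, `iterFrom`); Mathlib otherwise; no `sorry`/`axiom`.  Unit `b2b-balaban-pv12` gen 4
(journal CLAIM T4-O3b.K); records GAPS C-pv12g4-4 / G-pv12g4-2.
-/

open scoped BigOperators ENNReal
open _root_.MeasureTheory Function Finset

namespace Literature.MathematicalPhysics.QuantumFieldTheory.Balaban1983to89.T4OscSandwich

open B15.BasicStep T4DressedR T4Continuum T4AvgSensitivity

section SetupLevel

variable {P : Params} {j : ℕ} {G : Type*} [GaugeGroup G] [MeasurableSpace G] [HaarData G]
variable [DecidableEq (PBond P j)]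

/-! ## §1 Pointwise fibre comparison (bounds on the fibre through `V`, on the support of the integrated density) -/

/-- UPPER fibre comparison AT A POINT: `0 ≤ f ≤ C`, and `w(V←y) ≤ M` (`0 ≤ M`) for every fibre point `V←y` at which
`f ≠ 0` ⇒ `∫⌈(f·w)(V) ≤ M·∫⌈f(V)`.  No measurability and no global bound on `w` is needed. [folklore] -/
theorem fibreIntegral_mul_le_at (s : Finset (PBond P j)) {f w : Density P j G}
    (hf0 : ∀ U, 0 ≤ f U) {C : ℝ} (hfC : ∀ U, f U ≤ C) (V : GaugeField P j G) {M : ℝ} (hM0 : 0 ≤ M)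
    (hwM : ∀ y : s → G, f (updateFinset V s y) ≠ 0 → w (updateFinset V s y) ≤ M) :
    fibreIntegral s (fun U => f U * w U) V ≤ M * fibreIntegral s f V := by
  set μH : PBond P j → Measure G := fun _ => (HaarData.haar : Measure G) with hμH
  have hpt : ∀ y : s → G, ENNReal.ofReal (f (updateFinset V s y) * w (updateFinset V s y))
      ≤ ENNReal.ofReal M * ENNReal.ofReal (f (updateFinset V s y)) := by
    intro y
    rw [← ENNReal.ofReal_mul hM0]
    refine ENNReal.ofReal_le_ofReal ?_
    by_cases hfy : f (updateFinset V s y) = 0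
    · rw [hfy]; simp
    · rw [mul_comm]
      exact mul_le_mul_of_nonneg_right (hwM y hfy) (hf0 _)
  have h1 : (∫⋯∫⁻_s, (fun U => ENNReal.ofReal (f U * w U)) ∂μH) V
      ≤ ENNReal.ofReal M * (∫⋯∫⁻_s, (fun U => ENNReal.ofReal (f U)) ∂μH) V := by
    simp only [lmarginal]
    rw [← lintegral_const_mul' _ _ ENNReal.ofReal_ne_top]
    exact lintegral_mono (fun y => hpt y)
  have hfin : ENNReal.ofReal M * (∫⋯∫⁻_s, (fun U => ENNReal.ofReal (f U)) ∂μH) V ≠ ∞ :=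
    ENNReal.mul_ne_top ENNReal.ofReal_ne_top
      (ne_top_of_le_ne_top ENNReal.ofReal_ne_top (lmarginal_ofReal_le s hfC V))
  simp only [fibreIntegral]
  calc ((∫⋯∫⁻_s, (fun U => ENNReal.ofReal (f U * w U)) ∂μH) V).toReal
      ≤ (ENNReal.ofReal M * (∫⋯∫⁻_s, (fun U => ENNReal.ofReal (f U)) ∂μH) V).toReal :=
        ENNReal.toReal_mono hfin h1
    _ = M * ((∫⋯∫⁻_s, (fun U => ENNReal.ofReal (f U)) ∂μH) V).toReal := by
        rw [ENNReal.toReal_mul, ENNReal.toReal_ofReal hM0]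

/-- LOWER fibre comparison AT A POINT: `0 ≤ f ≤ C`, and `m ≤ w(V←y) ≤ M` (`0 ≤ m`, `0 ≤ M`) for every fibre point at
which `f ≠ 0` ⇒ `m·∫⌈f(V) ≤ ∫⌈(f·w)(V)` (the upper bound only makes the dressed fibre integral finite). [folklore] -/
theorem mul_fibreIntegral_le_at (s : Finset (PBond P j)) {f w : Density P j G}
    (hf0 : ∀ U, 0 ≤ f U) {C : ℝ} (hfC : ∀ U, f U ≤ C) (V : GaugeField P j G) {m M : ℝ} (hm0 : 0 ≤ m) (hM0 : 0 ≤ M)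
    (hmw : ∀ y : s → G, f (updateFinset V s y) ≠ 0 → m ≤ w (updateFinset V s y))
    (hwM : ∀ y : s → G, f (updateFinset V s y) ≠ 0 → w (updateFinset V s y) ≤ M) :
    m * fibreIntegral s f V ≤ fibreIntegral s (fun U => f U * w U) V := by
  set μH : PBond P j → Measure G := fun _ => (HaarData.haar : Measure G) with hμH
  have hlo : ∀ y : s → G, ENNReal.ofReal m * ENNReal.ofReal (f (updateFinset V s y))
      ≤ ENNReal.ofReal (f (updateFinset V s y) * w (updateFinset V s y)) := by
    intro y
    rw [← ENNReal.ofReal_mul hm0]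
    refine ENNReal.ofReal_le_ofReal ?_
    by_cases hfy : f (updateFinset V s y) = 0
    · rw [hfy]; simp
    · rw [mul_comm]
      exact mul_le_mul_of_nonneg_left (hmw y hfy) (hf0 _)
  have hhi : ∀ y : s → G, ENNReal.ofReal (f (updateFinset V s y) * w (updateFinset V s y))
      ≤ ENNReal.ofReal M * ENNReal.ofReal (f (updateFinset V s y)) := by
    intro y
    rw [← ENNReal.ofReal_mul hM0]
    refine ENNReal.ofReal_le_ofReal ?_
    by_cases hfy : f (updateFinset V s y) = 0
    · rw [hfy]; simp
    · rw [mul_comm]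
      exact mul_le_mul_of_nonneg_right (hwM y hfy) (hf0 _)
  have h1 : ENNReal.ofReal m * (∫⋯∫⁻_s, (fun U => ENNReal.ofReal (f U)) ∂μH) V
      ≤ (∫⋯∫⁻_s, (fun U => ENNReal.ofReal (f U * w U)) ∂μH) V := by
    simp only [lmarginal]
    rw [← lintegral_const_mul' _ _ ENNReal.ofReal_ne_top]
    exact lintegral_mono (fun y => hlo y)
  have h2 : (∫⋯∫⁻_s, (fun U => ENNReal.ofReal (f U * w U)) ∂μH) V
      ≤ ENNReal.ofReal M * (∫⋯∫⁻_s, (fun U => ENNReal.ofReal (f U)) ∂μH) V := by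
    simp only [lmarginal]
    rw [← lintegral_const_mul' _ _ ENNReal.ofReal_ne_top]
    exact lintegral_mono (fun y => hhi y)
  have hfin : (∫⋯∫⁻_s, (fun U => ENNReal.ofReal (f U * w U)) ∂μH) V ≠ ∞ :=
    ne_top_of_le_ne_top (ENNReal.mul_ne_top ENNReal.ofReal_ne_top
      (ne_top_of_le_ne_top ENNReal.ofReal_ne_top (lmarginal_ofReal_le s hfC V))) h2
  simp only [fibreIntegral]
  calc m * ((∫⋯∫⁻_s, (fun U => ENNReal.ofReal (f U)) ∂μH) V).toReal
      = (ENNReal.ofReal m * (∫⋯∫⁻_s, (fun U => ENNReal.ofReal (f U)) ∂μH) V).toReal := by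
        rw [ENNReal.toReal_mul, ENNReal.toReal_ofReal hm0]
    _ ≤ ((∫⋯∫⁻_s, (fun U => ENNReal.ofReal (f U * w U)) ∂μH) V).toReal := ENNReal.toReal_mono hfin h1

/-! ## §2 Per-term dressed sandwich and the oscillation form for `w = exp(t·F)` -/

/-- PER-TERM DRESSED SANDWICH AT A POINT: for nonnegative insert `ins`, integrated density `0 ≤ old ≤ C`, and a dressing
`w` with `m ≤ w(V←y) ≤ M` at every fibre point where `old ≠ 0` — required only when `ins V ≠ 0`, else both sides vanish —
`m·term(ℝρ)(V) ≤ term(ℝ_in(ρ·w))(V) ≤ M·term(ℝρ)(V)`. [folklore] -/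
theorem normTerm_dressed_sandwich_at (s : Finset (PBond P j)) {ins old w : Density P j G}
    (hins0 : ∀ U, 0 ≤ ins U) (hold0 : ∀ U, 0 ≤ old U) {C : ℝ} (holdC : ∀ U, old U ≤ C)
    (V : GaugeField P j G) {m M : ℝ} (hm0 : 0 ≤ m) (hM0 : 0 ≤ M)
    (hmw : ins V ≠ 0 → ∀ y : s → G, old (updateFinset V s y) ≠ 0 → m ≤ w (updateFinset V s y))
    (hwM : ins V ≠ 0 → ∀ y : s → G, old (updateFinset V s y) ≠ 0 → w (updateFinset V s y) ≤ M) :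
    m * normTerm s ins old V ≤ normTerm s ins (fun U => old U * w U) V ∧
    normTerm s ins (fun U => old U * w U) V ≤ M * normTerm s ins old V := by
  by_cases hins : ins V = 0
  · simp only [normTerm, hins, zero_mul, mul_zero, le_refl, and_self]
  · have hden0 : 0 ≤ fibreIntegral s ins V := ENNReal.toReal_nonneg
    have hlo := mul_fibreIntegral_le_at s hold0 holdC V hm0 hM0 (hmw hins) (hwM hins)
    have hhi := fibreIntegral_mul_le_at s hold0 holdC V hM0 (hwM hins)
    simp only [normTerm]
    constructor
    · calc m * (ins V * (fibreIntegral s old V / fibreIntegral s ins V))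
          = ins V * (m * fibreIntegral s old V / fibreIntegral s ins V) := by ring
        _ ≤ ins V * (fibreIntegral s (fun U => old U * w U) V / fibreIntegral s ins V) :=
          mul_le_mul_of_nonneg_left (div_le_div_of_nonneg_right hlo hden0) (hins0 V)
    · calc ins V * (fibreIntegral s (fun U => old U * w U) V / fibreIntegral s ins V)
          ≤ ins V * (M * fibreIntegral s old V / fibreIntegral s ins V) :=
            mul_le_mul_of_nonneg_left (div_le_div_of_nonneg_right hhi hden0) (hins0 V)
        _ = M * (ins V * (fibreIntegral s old V / fibreIntegral s ins V)) := by ring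

omit [GaugeGroup G] [MeasurableSpace G] [HaarData G] [DecidableEq (PBond P j)] in
/-- An oscillation bound on the exponent squeezes the exponential dressing around its value at the base point:
`|F(U) − F(V)| ≤ δ` ⇒ `e^{tF(V)}·e^{−|t|δ} ≤ e^{tF(U)} ≤ e^{tF(V)}·e^{|t|δ}`. [folklore] -/
theorem exp_osc_bounds {F : Density P j G} {t δ : ℝ} {V U : GaugeField P j G} (h : |F U - F V| ≤ δ) :
    Real.exp (t * F V) * Real.exp (-(|t| * δ)) ≤ Real.exp (t * F U) ∧
    Real.exp (t * F U) ≤ Real.exp (t * F V) * Real.exp (|t| * δ) := by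
  rw [← Real.exp_add, ← Real.exp_add, Real.exp_le_exp, Real.exp_le_exp]
  have h1 : |t * (F U - F V)| ≤ |t| * δ := by
    rw [abs_mul]
    exact mul_le_mul_of_nonneg_left h (abs_nonneg t)
  have h2 := neg_abs_le (t * (F U - F V))
  have h3 := le_abs_self (t * (F U - F V))
  have e : t * F U = t * F V + t * (F U - F V) := by ring
  constructor <;> linarith

/-- PER-TERM OSCILLATION SANDWICH: if `|F(V←y) − F(V)| ≤ δ` at every fibre point where the integrated density is nonzero
(and the insert is nonzero at `V`), then
`e^{tF(V)}e^{−|t|δ}·term(ℝρ)(V) ≤ term(ℝ_in(ρ·e^{tF}))(V) ≤ e^{tF(V)}e^{|t|δ}·term(ℝρ)(V)`. [folklore] -/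
theorem normTerm_exp_osc_sandwich (s : Finset (PBond P j)) {ins old : Density P j G} (F : Density P j G)
    (hins0 : ∀ U, 0 ≤ ins U) (hold0 : ∀ U, 0 ≤ old U) {C : ℝ} (holdC : ∀ U, old U ≤ C) (t δ : ℝ)
    (V : GaugeField P j G)
    (hosc : ins V ≠ 0 → ∀ y : s → G, old (updateFinset V s y) ≠ 0 → |F (updateFinset V s y) - F V| ≤ δ) :
    Real.exp (t * F V) * Real.exp (-(|t| * δ)) * normTerm s ins old V
      ≤ normTerm s ins (fun U => old U * Real.exp (t * F U)) V ∧
    normTerm s ins (fun U => old U * Real.exp (t * F U)) V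
      ≤ Real.exp (t * F V) * Real.exp (|t| * δ) * normTerm s ins old V :=
  normTerm_dressed_sandwich_at s hins0 hold0 holdC V (by positivity) (by positivity)
    (fun h y hy => (exp_osc_bounds (hosc h y hy)).1) (fun h y hy => (exp_osc_bounds (hosc h y hy)).2)

/-! ## §3 Summed over the terms: the dressed basic operation `ℝ_in(ρ·e^{tF})` against `ℝρ` -/

/-- OSCILLATION SANDWICH, termwise budgets: with `δ_Z` bounding the oscillation of `F` over the fibre of term `Z` through
`V` on the support of `ρ(Z,·)` (needed only where the insert `ρ(Z″,V) ≠ 0`),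
`Σ_Z e^{tF(V)}e^{−|t|δ_Z}·term_Z(ℝρ)(V) ≤ ℝ_in(ρ·e^{tF})(V) ≤ Σ_Z e^{tF(V)}e^{|t|δ_Z}·term_Z(ℝρ)(V)`. [folklore] -/
theorem ropRealIn_exp_osc_sandwich {R : Type*} [Fintype R] (piece : R → Density P j G) (pp : R → R)
    (fib : R → Finset (PBond P j)) (F : Density P j G) (t : ℝ) (δ : R → ℝ)
    (h0 : ∀ Z U, 0 ≤ piece Z U) {C : ℝ} (hC : ∀ Z U, piece Z U ≤ C) (V : GaugeField P j G)
    (hosc : ∀ Z, piece (pp Z) V ≠ 0 → ∀ y : fib Z → G, piece Z (updateFinset V (fib Z) y) ≠ 0 →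
      |F (updateFinset V (fib Z) y) - F V| ≤ δ Z) :
    ∑ Z, Real.exp (t * F V) * Real.exp (-(|t| * δ Z)) * normTerm (fib Z) (piece (pp Z)) (piece Z) V
      ≤ RopRealIn piece pp fib (fun U => Real.exp (t * F U)) V ∧
    RopRealIn piece pp fib (fun U => Real.exp (t * F U)) V
      ≤ ∑ Z, Real.exp (t * F V) * Real.exp (|t| * δ Z) * normTerm (fib Z) (piece (pp Z)) (piece Z) V := by
  constructor
  · simp only [RopRealIn]
    exact Finset.sum_le_sum (fun Z _ =>
      (normTerm_exp_osc_sandwich (fib Z) F (h0 (pp Z)) (h0 Z) (hC Z) t (δ Z) V (hosc Z)).1)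
  · simp only [RopRealIn]
    exact Finset.sum_le_sum (fun Z _ =>
      (normTerm_exp_osc_sandwich (fib Z) F (h0 (pp Z)) (h0 Z) (hC Z) t (δ Z) V (hosc Z)).2)

/-- OSCILLATION SANDWICH, one budget (the row's statement with the factor `w(V) = e^{tF(V)}` restored): if `δ₀` bounds the
oscillation of `F` over every term's fibre through `V` (on the supports), then
`e^{tF(V)}e^{−|t|δ₀}·(ℝρ)(V) ≤ ℝ_in(ρ·e^{tF})(V) ≤ e^{tF(V)}e^{|t|δ₀}·(ℝρ)(V)`.  (`T4DressedR.ropRealIn_exp_sandwich` is the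
sup-bound case; the spectator identity `T4DressedR.ropRealIn_eq_mul_of_fibreIndep` is `δ₀ = 0`.) [folklore] -/
theorem ropRealIn_exp_osc_sandwich_unif {R : Type*} [Fintype R] (piece : R → Density P j G) (pp : R → R)
    (fib : R → Finset (PBond P j)) (F : Density P j G) (t δ₀ : ℝ)
    (h0 : ∀ Z U, 0 ≤ piece Z U) {C : ℝ} (hC : ∀ Z U, piece Z U ≤ C) (V : GaugeField P j G)
    (hosc : ∀ Z, piece (pp Z) V ≠ 0 → ∀ y : fib Z → G, piece Z (updateFinset V (fib Z) y) ≠ 0 →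
      |F (updateFinset V (fib Z) y) - F V| ≤ δ₀) :
    Real.exp (t * F V) * Real.exp (-(|t| * δ₀)) * RopReal piece pp fib V
      ≤ RopRealIn piece pp fib (fun U => Real.exp (t * F U)) V ∧
    RopRealIn piece pp fib (fun U => Real.exp (t * F U)) V
      ≤ Real.exp (t * F V) * Real.exp (|t| * δ₀) * RopReal piece pp fib V := by
  have h := ropRealIn_exp_osc_sandwich piece pp fib F t (fun _ => δ₀) h0 hC V hosc
  simp only [RopReal, Finset.mul_sum]
  exact h

/-! ## §4 Consumer form: the budget supplied by `LoopOscBound` (node O3c, NE1a — a HYPOTHESIS) -/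

omit [MeasurableSpace G] [HaarData G] [DecidableEq (PBond P j)] in
/-- The dressing exponent of node O3b: the level-`(j+n)` loop variable `W_C(avg^n V)` of the `n`-fold averaged level-`j`
field along the closed walk `(x, w)`, as a level-`j` density. [folklore] -/
def loopDressing (av : ∀ i, Averaging P i G) (j n : ℕ) (x : Site P (j + n)) (w : List (Letter P.d)) :
    Density P j G :=
  fun U => loopAt (iterFrom av j n U) (walk x w)

/-- WHERE NE1a IS SPENT (one basic step, termwise): under `LoopOscBound av dom C_W θ`, for a closed walk at level
`j + n ≤ m + K` and pieces supported in the domain `dom j`, the dressed operation with `w = exp(t·W_C(avg^n ·))` satisfies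
the oscillation sandwich with budgets `δ_Z = C_W·|w|·|fib Z|·θ^n`. [folklore] -/
theorem ropRealIn_loopDressing_sandwich {av : ∀ i, Averaging P i G} {dom : ∀ i, Set (GaugeField P i G)}
    {C_W θ : ℝ} (hW : LoopOscBound av dom C_W θ) (n : ℕ) (hn : j + n ≤ P.m + P.K) (x : Site P (j + n))
    (w : List (Letter P.d)) (hw : walkEnd x w = x)
    {R : Type*} [Fintype R] (piece : R → Density P j G) (pp : R → R) (fib : R → Finset (PBond P j))
    (h0 : ∀ Z U, 0 ≤ piece Z U) {C : ℝ} (hC : ∀ Z U, piece Z U ≤ C)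
    (hdom : ∀ Z U, piece Z U ≠ 0 → U ∈ dom j) (t : ℝ) (V : GaugeField P j G) :
    ∑ Z, Real.exp (t * loopDressing av j n x w V)
        * Real.exp (-(|t| * (C_W * (w.length : ℝ) * ((fib Z).card : ℝ) * θ ^ n)))
        * normTerm (fib Z) (piece (pp Z)) (piece Z) V
      ≤ RopRealIn piece pp fib (fun U => Real.exp (t * loopDressing av j n x w U)) V ∧
    RopRealIn piece pp fib (fun U => Real.exp (t * loopDressing av j n x w U)) V
      ≤ ∑ Z, Real.exp (t * loopDressing av j n x w V)
        * Real.exp (|t| * (C_W * (w.length : ℝ) * ((fib Z).card : ℝ) * θ ^ n))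
        * normTerm (fib Z) (piece (pp Z)) (piece Z) V := by
  refine ropRealIn_exp_osc_sandwich piece pp fib (loopDressing av j n x w) t
    (fun Z => C_W * (w.length : ℝ) * ((fib Z).card : ℝ) * θ ^ n) h0 hC V (fun Z hZ y hy => ?_)
  have hV : V ∈ dom j := hdom (pp Z) V hZ
  have hV' : updateFinset V (fib Z) y ∈ dom j := hdom Z _ hy
  have h := hW.updateFinset n hn x w hw (fib Z) V y hV hV'
  rw [abs_sub_comm] at h
  exact h

/-- Uniform consumer form: if every term integrates at most `N` bond variables and `0 ≤ C_W`, `0 ≤ θ`, then with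
`δ₀ = C_W·|w|·N·θ^n`:  `e^{tF(V)}e^{−|t|δ₀}·(ℝρ)(V) ≤ ℝ_in(ρ·e^{tF})(V) ≤ e^{tF(V)}e^{|t|δ₀}·(ℝρ)(V)`, `F = W_C(avg^n ·)` —
"the observable leaves the step's Λ-integrals at the cost e^{±|t|δ₀}", geometric in `n` iff `θ < 1`. [folklore] -/
theorem ropRealIn_loopDressing_sandwich_unif {av : ∀ i, Averaging P i G} {dom : ∀ i, Set (GaugeField P i G)}
    {C_W θ : ℝ} (hW : LoopOscBound av dom C_W θ) (hCW : 0 ≤ C_W) (hθ : 0 ≤ θ) (n : ℕ) (hn : j + n ≤ P.m + P.K)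
    (x : Site P (j + n)) (w : List (Letter P.d)) (hw : walkEnd x w = x)
    {R : Type*} [Fintype R] (piece : R → Density P j G) (pp : R → R) (fib : R → Finset (PBond P j))
    (h0 : ∀ Z U, 0 ≤ piece Z U) {C : ℝ} (hC : ∀ Z U, piece Z U ≤ C)
    (hdom : ∀ Z U, piece Z U ≠ 0 → U ∈ dom j) {N : ℕ} (hN : ∀ Z, (fib Z).card ≤ N) (t : ℝ) (V : GaugeField P j G) :
    Real.exp (t * loopDressing av j n x w V) * Real.exp (-(|t| * (C_W * (w.length : ℝ) * (N : ℝ) * θ ^ n)))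
        * RopReal piece pp fib V
      ≤ RopRealIn piece pp fib (fun U => Real.exp (t * loopDressing av j n x w U)) V ∧
    RopRealIn piece pp fib (fun U => Real.exp (t * loopDressing av j n x w U)) V
      ≤ Real.exp (t * loopDressing av j n x w V) * Real.exp (|t| * (C_W * (w.length : ℝ) * (N : ℝ) * θ ^ n))
        * RopReal piece pp fib V := by
  refine ropRealIn_exp_osc_sandwich_unif piece pp fib (loopDressing av j n x w) t _ h0 hC V (fun Z hZ y hy => ?_)
  have hV : V ∈ dom j := hdom (pp Z) V hZ
  have hV' : updateFinset V (fib Z) y ∈ dom j := hdom Z _ hy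
  have h := hW.updateFinset n hn x w hw (fib Z) V y hV hV'
  rw [abs_sub_comm] at h
  refine h.trans ?_
  have hcard : ((fib Z).card : ℝ) ≤ (N : ℝ) := by exact_mod_cast hN Z
  have h1 : 0 ≤ C_W * (w.length : ℝ) := mul_nonneg hCW (Nat.cast_nonneg _)
  have h2 : 0 ≤ θ ^ n := pow_nonneg hθ n
  calc C_W * (w.length : ℝ) * ((fib Z).card : ℝ) * θ ^ n
      ≤ C_W * (w.length : ℝ) * (N : ℝ) * θ ^ n :=
        mul_le_mul_of_nonneg_right (mul_le_mul_of_nonneg_left hcard h1) h2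

end SetupLevel

end Literature.MathematicalPhysics.QuantumFieldTheory.Balaban1983to89.T4OscSandwich
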